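import Literature.AnabelianGeometry.AbsoluteAnabelian.MLFReciprocityInputs
import Literature.AnabelianGeometry.AbsoluteAnabelian.MLFTorsionCardProofs
import Literature.AnabelianGeometry.AbsoluteAnabelian.MLFUnramifiedCriterionProofs
import Literature.AnabelianGeometry.AbsoluteAnabelian.MLFInertiaProofs
import Literature.AnabelianGeometry.AbsoluteAnabelian.MLFFrobeniusProofs
import Literature.AnabelianGeometry.AbsoluteAnabelian.MLFRootsOfUnityProofs
import Literature.AnabelianGeometry.AbsoluteAnabelian.MLFSlimProofs
import Literature.AnabelianGeometry.AbsoluteAnabelian.AbsAnabResidueCardProofs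
import Literature.AnabelianGeometry.AbsoluteAnabelian.AbsTopISemiAbsolute
import HarnessLib

/-!
# [AbsAnab] Prop 1.2.1 / Thm 1.1.1 (ii): the deductions rewired onto the NAMED inputs

The proof-only companions `MLFGaloisGroupsProofs`, `MLFInertiaProofs`, `MLFFrobeniusProofs`,
`MLFRootsOfUnityProofs`, `MLFSlimProofs`, `AbsAnabResidueCardProofs` deduce the named facts of
abc-iut-L4-t4's `MLFGaloisGroups.lean` / `AbsAnabFundamentalGroups.lean` ([AbsAnab] Prop 1.2.1
(i) (ii) (iv) (v) (vi), Thm 1.1.1 (ii) local half, §1.3 p. 19 "`q₁ = q₂`") from explicit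
hypotheses.  This file states the same deductions with the hypotheses replaced by NAMED facts:

* the LCFT rank formula `FundamentalExtension.thm26_ii_delta_gal` ([AbsTopI] Thm 2.6 (ii),
  `AbsTopISemiAbsolute.lean`) — still a named fact;
* `mlf_torsion_card`, `mlf_torsion_card_subextension` — PROVED (`MLFTorsionCardProofs.lean`, from
  the tree's local class field theory), hence eliminated;
* `mlf_unramified_criterion` — PROVED (`MLFUnramifiedCriterionProofs.lean`), hence eliminated;
* `mlf_reciprocity_equivariant` (`MLFReciprocityInputs.lean`) — still a named fact (it needs the
  CANONICAL Artin map, not only the existence statement `exists_isLocalReciprocityMap_holds`).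

So: Prop 1.2.1 (i), (ii), (v) and p. 19 `q₁ = q₂` ⇐ `thm26_ii_delta_gal` alone; (iv) ⇐
`thm26_ii_delta_gal` + `mlf_reciprocity_equivariant`; (vi) (both clauses) and `galoisMLF_slim` ⇐
`mlf_reciprocity_equivariant`.  Proof-only; one-line applications.
HONEST FRAMING: no bearing on [IUTchIII] Cor. 3.12.
-/

noncomputable section

namespace Literature.AnabelianGeometry.AbsoluteAnabelian

open Field

/-- [AbsAnab] Prop 1.2.1 (i) `p₁ = p₂` ⇐ the LCFT rank formula ([AbsTopI] Thm 2.6 (ii)).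
[cite: MochizukiAbsAnab2004, Prop 1.2.1 (i) p.10] -/
theorem galoisMLF_iso_residueChar_eq_of_delta (h : FundamentalExtension.thm26_ii_delta_gal) :
    galoisMLF_iso_residueChar_eq :=
  galoisMLF_iso_residueChar_eq_of_rank h

/-- [AbsAnab] Prop 1.2.1 (v) `[K₁:ℚ_p] = [K₂:ℚ_p]`, `|k₁| = |k₂|` ⇐ the LCFT rank formula (the
torsion count being PROVED, `mlf_torsion_card_holds`). [cite: MochizukiAbsAnab2004, Prop 1.2.1 (v) p.10] -/
theorem galoisMLF_iso_degrees_of_delta (h : FundamentalExtension.thm26_ii_delta_gal) :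
    galoisMLF_iso_degrees :=
  galoisMLF_iso_degrees_of_rank_of_torsion h mlf_torsion_card_holds

/-- [AbsAnab] Prop 1.2.1 (ii) `α(I_{K₁}) = I_{K₂}` ⇐ the LCFT rank formula (the torsion count on
subextensions and the unramifiedness criterion being PROVED). [cite: MochizukiAbsAnab2004, Prop 1.2.1 (ii) p.10] -/
theorem galoisMLF_iso_inertia_of_delta (h : FundamentalExtension.thm26_ii_delta_gal) :
    galoisMLF_iso_inertia :=
  galoisMLF_iso_inertia_of_rank_of_torsion_of_unramified h mlf_torsion_card_subextension_holds
    mlf_unramified_criterion_holds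

/-- [AbsAnab] Prop 1.2.1 (iv) Frobenius lifts ⇐ the LCFT rank formula + the equivariant
reciprocity map. [cite: MochizukiAbsAnab2004, Prop 1.2.1 (iv) p.10] -/
theorem galoisMLF_iso_frobenius_of_delta_of_reciprocity (h : FundamentalExtension.thm26_ii_delta_gal)
    (hA : mlf_reciprocity_equivariant) : galoisMLF_iso_frobenius :=
  galoisMLF_iso_frobenius_of_rank_of_torsion_of_reciprocity h mlf_torsion_card_holds hA

/-- [AbsAnab] Prop 1.2.1 (vi) "in particular" (cyclotomic characters) ⇐ the equivariant
reciprocity map. [cite: MochizukiAbsAnab2004, Prop 1.2.1 (vi) p.11] -/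
theorem galoisMLF_iso_cyclotomicChar_of_reciprocityFact (hA : mlf_reciprocity_equivariant) :
    galoisMLF_iso_cyclotomicChar :=
  galoisMLF_iso_cyclotomicChar_of_reciprocity hA

/-- [AbsAnab] Prop 1.2.1 (vi) main clause (`α`-equivariant `μ(K̄₁) ≅ μ(K̄₂)`) ⇐ the equivariant
reciprocity map. [cite: MochizukiAbsAnab2004, Prop 1.2.1 (vi) p.10] -/
theorem galoisMLF_iso_rootsOfUnity_of_reciprocityFact (hA : mlf_reciprocity_equivariant) :
    galoisMLF_iso_rootsOfUnity :=
  galoisMLF_iso_rootsOfUnity_of_reciprocity hA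

/-- [AbsAnab] Thm 1.1.1 (ii) local half (`G_K` slim) ⇐ the equivariant reciprocity map.
[cite: MochizukiAbsAnab2004, Thm 1.1.1 (ii) p.6] -/
theorem galoisMLF_slim_of_reciprocityFact (hA : mlf_reciprocity_equivariant) : galoisMLF_slim :=
  galoisMLF_slim_of_reciprocity hA

/-- [AbsAnab] §1.3 p. 19 "Lemma 1.3.8, Prop 1.2.1 (v) imply `q₁ = q₂`" ⇐ the LCFT rank formula.
[cite: MochizukiAbsAnab2004, §1.3 p.19] -/
theorem FundamentalExtension.sameResidueCard_of_preservesGeom_of_delta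
    (h : FundamentalExtension.thm26_ii_delta_gal) {E F : FundamentalExtension.{0}}
    (B₁ : E.MLFBase) (B₂ : F.MLFBase) {α : E.arith ≃ₜ* F.arith}
    (hα : FundamentalExtension.PreservesGeom α) : FundamentalExtension.SameResidueCard B₁ B₂ :=
  FundamentalExtension.sameResidueCard_of_preservesGeom h mlf_torsion_card_holds B₁ B₂ hα

end Literature.AnabelianGeometry.AbsoluteAnabelian
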